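import Summits.BirchSwinnertonDyer.BirchSwinnertonDyer.Theorems.GenusKolyvaginAtTwoSupplyKernelsLossless
import Summits.BirchSwinnertonDyer.BirchSwinnertonDyer.Theses.ByReductionTypeAtTwo
import HarnessLib

/-!
# Route `GenusKolyvaginAtTwo`: the depth-zero kernels K1Neg (stmt-BirchSwinnertonDyer-31525) and K1Pos (stmt-BirchSwinnertonDyer-31468) FOLLOW
# BY NAME from WALL row 1 + U₂ `MinimalTwinBSDTwo` (stmt-22985) + PRINT — they are not independent K-inputs of the route

Seat `bsd-line-gk2-p2` g28 (PROVER seat 2/3, cell `bsd-f1-sign2`; LINE 23 holder on U₂), `--supports stmt-BirchSwinnertonDyer-31525` (helper;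
closes nothing: the antecedents WALL / U₂ / PRINT are OPEN route items).  THEOREMS ONLY (no definition, no named fact, no `sorry`); standard
axioms.  **BSD is NOT proved by this file; K1Neg, K1Pos, U₂, the WALL rows are NOT proved; no item is closed.**

THE POINT (census / LEAD g29's «23491 END-TO-END» assembly).  gk2-p5 g34 proved the kernels LOSSLESS from the LEAF
(`GenusSupplyNarrow.Lossless.K1_of_nonCMAtTwo` / `K1_pos_of_nonCMAtTwo`: `NonCMAtTwo` + PRINT ⟹ K₁, K₁⁺), and LEAD g24 read them per curve
(`…KFourCellLeafCurrency.depth_eq_zero_iff_bsdp_of_natCard_selmerGroup_eq_one`).  The leaf is used there at exactly TWO curves: the rank-`0`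
member `E` with `#Sel₂(E) = 1` — an instance of WALL row 1 (route ByReductionTypeAtTwo, items 19095–19098; in LINE 23's currency S1) — and the
rank-`1` twin `Wd` with `#Sel₂(Wd) = 2` — an instance of U₂ `MinimalTwinBSDTwo` (22985) VERBATIM (non-CM: same `j`; `r_an(Wd) = 1`;
`#Sel₂(Wd) = 2` are K₁'s own binders).  Hence, BY NAME:

* §1 `k1Neg_of_rankZeroSelmerTrivial_of_minimalTwinBSDTwo` / `k1Pos_…` — **K1Neg, K1Pos ⟸ S1 + `MinimalTwinBSDTwo` + GZ/L/GZK/Milne**;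
  (S1 ⟸ WALL row 1 is LEAD g27's `GenusExact.Census.bsdp_rankZero_of_wallRows`, inlined in §2);
* §2 ★ `k1Neg_of_wallItems_of_minimalTwinBSDTwo` / ★ `k1Pos_of_wallItems_of_minimalTwinBSDTwo` — **K1Neg, K1Pos ⟸ `GoodOrdinaryRankZeroAtTwo` ∧
  `MultiplicativeRankZeroAtTwo` ∧ `SupersingularRankZeroAtTwo` ∧ `AdditiveRankZeroAtTwo` (19095–19098) + `MinimalTwinBSDTwo` (22985) +
  `GrossZagierAllLevels` (24148) + `EntireLFunctionRat` (19273) + `MultPublishedInputsAtTwo` (19921) + `MilneAnyModel` (24149)**.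

READING.  In any assembly that already carries WALL row 1 and U₂ as hypotheses (LEAD g29's `genusDeepSupplyAtTwoNegDiscNarrow_of_K1Neg_of_wallRows_U2`,
the pen's LINES 33–38, the K₄ roads «WALL + U₂ + Q2 + PRINT»), the binder K1Neg / K1Pos is REDUNDANT and can be discharged by §2.  (Inside the route's
`closes` it is NOT redundant: there BSD₂ of the rank-`0` K₁-cell curve is the OUTPUT, not an input.)  Nothing here is progress on BSD.

References: [GrossZagier1986] V.§2 (2.2); [Kramer1981] Thm. 1; [Milne1972ArithmeticAV] §1 Thm. 1; [McCallumLMS1991] §5 Lemma 5.1; [Miller2011LMS] Def. 1.1.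
-/

set_option autoImplicit false
set_option linter.dupNamespace false -- `Summit.<P>.<Sub>` repeats `BirchSwinnertonDyer` (D-0017)

noncomputable section

open scoped Classical

namespace Summit.BirchSwinnertonDyer.BirchSwinnertonDyer.Theorems.GenusSupplyNarrow.Lossless.OfWallU2

open WeierstrassCurve NumberField Literature.NumberTheory.EllipticCurves Literature.NumberTheory.EllipticCurves.ModularForms
  Summit.BirchSwinnertonDyer.BirchSwinnertonDyer.Theorems.GenusSupplyNarrow.Lossless
open Summit.BirchSwinnertonDyer.BirchSwinnertonDyer.Theses.GenusKolyvaginAtTwo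
open Summit.BirchSwinnertonDyer.BirchSwinnertonDyer.Theses.ByReductionTypeAtTwo
  (GoodOrdinaryRankZeroAtTwo MultiplicativeRankZeroAtTwo SupersingularRankZeroAtTwo AdditiveRankZeroAtTwo)

/-! ## §1 K₁, K₁⁺ from S1 (rank-zero `#Sel₂ = 1` wall) + U₂ + PRINT -/

/-- **K1Neg ⟸ S1 + U₂ + PRINT.**  `hS1` = BSD₂ for non-CM globally minimal curves of analytic rank `0` with `#Sel₂ = 1` (WALL row 1 restricted);
`hTw` = U₂ `MinimalTwinBSDTwo` (22985) BY NAME; PRINT = `GrossZagierAllLevels`, `EntireLFunctionRat`, `MultPublishedInputsAtTwo`, `MilneAnyModel`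
BY NAME.  CONCLUSION: the route decl `K1Neg` (31525).  Proof = gk2-p5 g34's `K1_of_nonCMAtTwo` with the leaf's two uses replaced: `BSD₂(E)` from
`hS1` (`r_an(E) = 0`, `#Sel₂(E) = 1`), `BSD₂(Wd)` from `hTw` (non-CM by `j`, `r_an(Wd) = 1`, `#Sel₂(Wd) = 2`); then
`natCard_primaryComponent_sha_baseChange_two_eq_pow_of_bsdp_pair` (`= 4^{M₀}`) against `…_eq_one_of_natCard_selmerGroup_eq_one` (`= 1`) forces
`M₀ = 0`, contradicting `1 ≤ M₀`.  CONDITIONAL on the displayed OPEN items; closes nothing.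
[cite: GrossZagier1986, V.§2 (2.2)] [cite: Kramer1981, Thm. 1] [cite: Milne1972ArithmeticAV, §1 Thm. 1] [cite: McCallumLMS1991, §5 Lemma 5.1] -/
theorem k1Neg_of_rankZeroSelmerTrivial_of_minimalTwinBSDTwo
    (hS1 : ∀ (W : WeierstrassCurve ℚ) [W.IsElliptic] [W.IsGloballyMinimal],
      ¬ W.HasCM → W.analyticRank = 0 → Nat.card (W.selmerGroup 2) = 1 → BSDp W 2)
    (hTw : MinimalTwinBSDTwo)
    (hGZ : GrossZagierAllLevels) (hL : EntireLFunctionRat) (hGZK : MultPublishedInputsAtTwo) (hMi : MilneAnyModel) : K1Neg := by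
  intro W _ _ _ hcm hr0 hρ hT hneg h1 K _ _ hIQ hodd h3 hHe _hsq1 _hsq2 Dt _hoptDt hc β ι d₁ hy M₀ hdiv hndiv hM Wd _ _ hWd hrd hSel hDEF
  have hρ2 : W.HasSurjectiveModNGaloisRep 2 := by simpa using hρ 1 one_pos
  have hD0 : (NumberField.discr K : ℚ) ≠ 0 := by exact_mod_cast NumberField.discr_ne_zero K
  -- `BSD₂(E)` from S1, `BSD₂(Wd)` from U₂
  have hBW : BSDp W 2 := hS1 W hcm hr0 h1
  obtain ⟨Cd, hCd⟩ := hWd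
  have hcmd : ¬ Wd.HasCM := RamifiedPairUpperBound.not_hasCM_of_smul_quadraticTwist_eq hD0 hCd hcm
  have hBd : BSDp Wd 2 := hTw Wd hcmd hrd hSel
  have hpow := natCard_primaryComponent_sha_baseChange_two_eq_pow_of_bsdp_pair hGZ hL hGZK hMi W hρ2 hT hr0 K hIQ hodd h3 hHe Dt hc β ι d₁ M₀
    hdiv hndiv Wd ⟨Cd, hCd⟩ hrd hBW hBd
  have hone := natCard_primaryComponent_sha_baseChange_two_eq_one_of_natCard_selmerGroup_eq_one W K hT hr0 h1 hIQ hodd hHe hρ2 Dt β ι d₁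
    hy M₀ hndiv Wd ⟨Cd, hCd⟩ hSel (Or.inl ⟨hneg, hDEF⟩)
  rw [hone] at hpow
  have h0 : 2 * M₀ = 0 := by
    rcases (Nat.pow_eq_one.mp hpow.symm) with h | h
    · exact absurd h (by norm_num)
    · exact h
  omega

/-- **K1Pos ⟸ S1 + U₂ + PRINT** — the `Δ > 0` twin (Tamagawa-ODD twin budget).  CONCLUSION: the route decl `K1Pos` (31468).  CONDITIONAL; closes nothing.
[cite: GrossZagier1986, V.§2 (2.2)] [cite: Kramer1981, Thm. 1] [cite: Milne1972ArithmeticAV, §1 Thm. 1] [cite: McCallumLMS1991, §5 Lemma 5.1] -/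
theorem k1Pos_of_rankZeroSelmerTrivial_of_minimalTwinBSDTwo
    (hS1 : ∀ (W : WeierstrassCurve ℚ) [W.IsElliptic] [W.IsGloballyMinimal],
      ¬ W.HasCM → W.analyticRank = 0 → Nat.card (W.selmerGroup 2) = 1 → BSDp W 2)
    (hTw : MinimalTwinBSDTwo)
    (hGZ : GrossZagierAllLevels) (hL : EntireLFunctionRat) (hGZK : MultPublishedInputsAtTwo) (hMi : MilneAnyModel) : K1Pos := by
  intro W _ _ _ hcm hr0 hρ hT hpos h1 K _ _ hIQ hodd h3 hHe _hsq1 _hsq2 Dt _hoptDt hc β ι d₁ hy M₀ hdiv hndiv hM Wd _ _ hWd hrd hSel hDEF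
  have hρ2 : W.HasSurjectiveModNGaloisRep 2 := by simpa using hρ 1 one_pos
  have hD0 : (NumberField.discr K : ℚ) ≠ 0 := by exact_mod_cast NumberField.discr_ne_zero K
  have hBW : BSDp W 2 := hS1 W hcm hr0 h1
  obtain ⟨Cd, hCd⟩ := hWd
  have hcmd : ¬ Wd.HasCM := RamifiedPairUpperBound.not_hasCM_of_smul_quadraticTwist_eq hD0 hCd hcm
  have hBd : BSDp Wd 2 := hTw Wd hcmd hrd hSel
  have hpow := natCard_primaryComponent_sha_baseChange_two_eq_pow_of_bsdp_pair hGZ hL hGZK hMi W hρ2 hT hr0 K hIQ hodd h3 hHe Dt hc β ι d₁ M₀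
    hdiv hndiv Wd ⟨Cd, hCd⟩ hrd hBW hBd
  have hone := natCard_primaryComponent_sha_baseChange_two_eq_one_of_natCard_selmerGroup_eq_one W K hT hr0 h1 hIQ hodd hHe hρ2 Dt β ι d₁
    hy M₀ hndiv Wd ⟨Cd, hCd⟩ hSel (Or.inr ⟨hpos, hDEF⟩)
  rw [hone] at hpow
  have h0 : 2 * M₀ = 0 := by
    rcases (Nat.pow_eq_one.mp hpow.symm) with h | h
    · exact absurd h (by norm_num)
    · exact h
  omega

/-! ## §2 BY NAME from the route items: WALL row 1 + U₂ + PRINT -/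

/-- ★ **K1Neg (stmt-BirchSwinnertonDyer-31525) ⟸ WALL row 1 items + U₂ (22985) + the four print items, BY NAME.**  So in every assembly already carrying
WALL row 1 and U₂ (LEAD g29's 23491 end-to-end, the K₄ roads), the K1Neg binder is dischargeable.  CONDITIONAL on OPEN items; closes nothing.
[cite: GrossZagier1986, V.§2 (2.2)] [cite: Kramer1981, Thm. 1] [cite: Milne1972ArithmeticAV, §1 Thm. 1] -/
theorem k1Neg_of_wallItems_of_minimalTwinBSDTwo
    (hOrd : GoodOrdinaryRankZeroAtTwo) (hMult : MultiplicativeRankZeroAtTwo) (hSS : SupersingularRankZeroAtTwo) (hAdd : AdditiveRankZeroAtTwo)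
    (hTw : MinimalTwinBSDTwo)
    (hGZ : GrossZagierAllLevels) (hL : EntireLFunctionRat) (hGZK : MultPublishedInputsAtTwo) (hMi : MilneAnyModel) : K1Neg :=
  k1Neg_of_rankZeroSelmerTrivial_of_minimalTwinBSDTwo
    (fun W _ _ hCM hr _ ↦ by
      -- S1 from WALL row 1 by the reduction-type tetrachotomy at `2` (as `GenusExact.Census.bsdp_rankZero_of_wallRows`, p783309)
      by_cases hg : W.HasGoodReductionAtPrime 2
      · by_cases hd : ((2 : ℕ) : ℤ) ∣ W.frobeniusTrace 2
        · exact hSS W hCM hr ⟨hg, hd⟩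
        · exact hOrd W hCM hr ⟨hg, hd⟩
      · by_cases hm : W.HasMultiplicativeReductionAtPrime 2
        · exact hMult W hCM hr hm
        · exact hAdd W hCM hr ⟨hg, hm⟩)
    hTw hGZ hL hGZK hMi

/-- ★ **K1Pos (stmt-BirchSwinnertonDyer-31468) ⟸ WALL row 1 items + U₂ (22985) + the four print items, BY NAME.**  CONDITIONAL on OPEN items; closes nothing.
[cite: GrossZagier1986, V.§2 (2.2)] [cite: Kramer1981, Thm. 1] [cite: Milne1972ArithmeticAV, §1 Thm. 1] -/
theorem k1Pos_of_wallItems_of_minimalTwinBSDTwo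
    (hOrd : GoodOrdinaryRankZeroAtTwo) (hMult : MultiplicativeRankZeroAtTwo) (hSS : SupersingularRankZeroAtTwo) (hAdd : AdditiveRankZeroAtTwo)
    (hTw : MinimalTwinBSDTwo)
    (hGZ : GrossZagierAllLevels) (hL : EntireLFunctionRat) (hGZK : MultPublishedInputsAtTwo) (hMi : MilneAnyModel) : K1Pos :=
  k1Pos_of_rankZeroSelmerTrivial_of_minimalTwinBSDTwo
    (fun W _ _ hCM hr _ ↦ by
      -- S1 from WALL row 1 by the reduction-type tetrachotomy at `2` (as `GenusExact.Census.bsdp_rankZero_of_wallRows`, p783309)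
      by_cases hg : W.HasGoodReductionAtPrime 2
      · by_cases hd : ((2 : ℕ) : ℤ) ∣ W.frobeniusTrace 2
        · exact hSS W hCM hr ⟨hg, hd⟩
        · exact hOrd W hCM hr ⟨hg, hd⟩
      · by_cases hm : W.HasMultiplicativeReductionAtPrime 2
        · exact hMult W hCM hr hm
        · exact hAdd W hCM hr ⟨hg, hm⟩)
    hTw hGZ hL hGZK hMi

end Summit.BirchSwinnertonDyer.BirchSwinnertonDyer.Theorems.GenusSupplyNarrow.Lossless.OfWallU2

end
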